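import Summits.CriticalPhenomena.PercolationContinuityZ3.Theorems.Transplant.FKDoubleFanOneSided
import HarnessLib

/-!
# Double fans `K₂ ∨ P_{m+1}`: the PINNED IMAGE of an `a`-fan — the cone `Σ`, its invariance under rim steps and `a`-spokes, and the
# cubic cone `x̂ŷẑ = û²v̂` through it (the algebraic obstruction behind the single-spoke normal form)

Helper file (`--supports stmt-CriticalPhenomena-4575`), FK sub-lane `prim-bschramm-fk-3` (gen 45); builds on p205010 (kernel theorem, internal
audit signed; external expert review pending).  Pure real algebra: no measures, no named facts, no sorries; standard axioms.
Memo `bschramm/prim-bschramm-fk-3/FAR-CROSS-XX.md` §1, §3a.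

A depth-1 `a`-plane `F_a·span(u, P_a u)` (`fanCombo q F`, `…DoubleFanOneSided`) always contains its PINNED VECTOR `F_a(P_a u) = fanCombo q F (AC_1 ∗ u)`.
In partition coordinates this vector is completely explicit (**`fanCombo_pinned`**):
`fanCombo q F (AC_1∗u) = (μY, μV, λY, 0, λV)`, `Y = u₀ + u_ac`, `V = u_ab + u_bc + u₁`, `λ = F_ac + F₁ + F_bc`, `μ = F₀ + F_ab`
(`= λ·π + μ·detach π`, `π = AC_1∗u`).  The set `Σ` of such vectors (`z_bc = 0`, `z₀z₁ = z_ab z_ac`) is mapped into itself by every rim step and every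
`a`-spoke with explicit new coefficients (**`rimStep_sigma`**: `λ ↦ rλ`, `μ ↦ rμ + (1−r)(λ + qμ)`; **`conv_edgeAC_sigma`**: `λ ↦ λ + xμ`, `μ ↦ (1−x)μ`) — so
the pinned vector of every depth-1 `a`-plane, however long the fan, stays in the 3-parameter cone `Σ`, which is why these planes form a hypersurface
of the Grassmannian (memo §1).  Second, the cubic form **`cubicC Z = x̂ŷẑ − û²v̂`** (hat coordinates) vanishes on `Σ` (**`cubicC_sigma`**,
**`cubicC_fanCombo_pinned`**) and is multiplied by `(1−x)²`, `(1−y)²`, `(1−w)²` under the single-edge letters `AC_x`, `BC_y`, `AB_w`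
(**`cubicC_conv_edgeAC/BC/AB`**); hence a plane of the form `BC_y ∗ (F_a·span(u', P_a u'))` contains a vector on the cubic cone
(**`cubicC_edgeBC_fanCombo_pinned`**) — the weight `y` of such a representation of a given plane is a root of a cubic, and the single-spoke normal form
of word planes fails exactly when no admissible root exists (memo §3a, explicit instance).  Rim steps do NOT preserve the cubic.
[folklore]
-/

noncomputable section

namespace Summit.CriticalPhenomena.PercolationContinuityZ3.Theorems

namespace FK

namespace ThreeApex

/-! ### The pinned image of an `a`-fan -/

/-- The vectors of `Σ` in partition coordinates: `σ(λ, μ; Y, V) = (μY, μV, λY, 0, λV)` (`= λ·π + μ·detach π` for `π = (0,0,Y,0,V)`). [folklore] -/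
def sigmaVec (lam mu Y V : ℝ) : V5 := ⟨mu * Y, mu * V, lam * Y, 0, lam * V⟩

/-- `AC_1 ∗ u = (0, 0, u₀+u_ac, 0, u_ab+u_bc+u₁) = σ(1, 0; Y, V)`. [folklore] -/
theorem conv_edgeAC_one_eq_sigma (u : V5) :
    conv (edgeAC 1) u = sigmaVec 1 0 (u.z0 + u.zac) (u.zab + u.zbc + u.z1) := by
  ext <;> simp only [conv, edgeAC, sigmaVec, V5.total] <;> ring

/-- `detach (AC_1 ∗ u) = (Y, V, 0, 0, 0) = σ(0, 1; Y, V)`. [folklore] -/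
theorem detach_conv_edgeAC_one_eq_sigma (q : ℝ) (u : V5) :
    detach q (conv (edgeAC 1) u) = sigmaVec 0 1 (u.z0 + u.zac) (u.zab + u.zbc + u.z1) := by
  ext <;> simp only [detach, conv, edgeAC, sigmaVec, V5.total] <;> ring

/-- **The pinned image of an `a`-fan**: `fanCombo q F (AC_1 ∗ u) = σ(F_ac+F₁+F_bc, F₀+F_ab; u₀+u_ac, u_ab+u_bc+u₁)`. [folklore] -/
theorem fanCombo_pinned (q : ℝ) (F u : V5) :
    fanCombo q F (conv (edgeAC 1) u) = sigmaVec (F.zac + F.z1 + F.zbc) (F.z0 + F.zab) (u.z0 + u.zac) (u.zab + u.zbc + u.z1) := by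
  ext <;> simp only [fanCombo, conv, edgeAC, detach, sigmaVec, V5.total] <;> ring

/-- `σ` is linear in `(λ, μ)`: the general element is `λ·π + μ·detach π`. [folklore] -/
theorem sigmaVec_eq (lam mu Y V : ℝ) :
    sigmaVec lam mu Y V = ⟨lam * (sigmaVec 1 0 Y V).z0 + mu * (sigmaVec 0 1 Y V).z0, lam * (sigmaVec 1 0 Y V).zab + mu * (sigmaVec 0 1 Y V).zab,
      lam * (sigmaVec 1 0 Y V).zac + mu * (sigmaVec 0 1 Y V).zac, lam * (sigmaVec 1 0 Y V).zbc + mu * (sigmaVec 0 1 Y V).zbc,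
      lam * (sigmaVec 1 0 Y V).z1 + mu * (sigmaVec 0 1 Y V).z1⟩ := by
  ext <;> simp only [sigmaVec] <;> ring

/-! ### Invariance of `Σ` under rim steps and `a`-spokes -/

/-- **Rim steps preserve `Σ`**: `E_r σ(λ, μ) = σ(rλ, rμ + (1−r)(λ + qμ))`. [folklore] -/
theorem rimStep_sigma (q r lam mu Y V : ℝ) :
    rimStep q r (sigmaVec lam mu Y V) = sigmaVec (r * lam) (r * mu + (1 - r) * (lam + q * mu)) Y V := by
  ext <;> simp only [rimStep, sigmaVec] <;> ring

/-- `detach` maps `Σ` to `Σ`: `detach σ(λ, μ) = σ(0, λ + qμ)`. [folklore] -/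
theorem detach_sigma (q lam mu Y V : ℝ) : detach q (sigmaVec lam mu Y V) = sigmaVec 0 (lam + q * mu) Y V := by
  ext <;> simp only [detach, sigmaVec] <;> ring

/-- **`a`-spokes preserve `Σ`**: `AC_x ∗ σ(λ, μ) = σ(λ + xμ, (1−x)μ)`. [folklore] -/
theorem conv_edgeAC_sigma (x lam mu Y V : ℝ) :
    conv (edgeAC x) (sigmaVec lam mu Y V) = sigmaVec (lam + x * mu) ((1 - x) * mu) Y V := by
  ext <;> simp only [conv, edgeAC, sigmaVec, V5.total] <;> ring

/-- Hence every `a`-fan maps `Σ` into `Σ`: `fanCombo q F σ(λ, μ) = σ(λ', μ')` with `λ' = F_acλ + F₁(λ+μ) + F_bc(λ+qμ)`,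
`μ' = F_acμ + F₀(λ+qμ) + F_ab(λ+μ)`. [folklore] -/
theorem fanCombo_sigma (q lam mu Y V : ℝ) (F : V5) :
    fanCombo q F (sigmaVec lam mu Y V) =
      sigmaVec (F.zac * lam + F.z1 * (lam + mu) + F.zbc * (lam + q * mu)) (F.zac * mu + F.z0 * (lam + q * mu) + F.zab * (lam + mu)) Y V := by
  ext <;> simp only [fanCombo, conv, edgeAC, detach, sigmaVec, V5.total] <;> ring

/-- A `b`-spoke does NOT preserve `Σ` (it creates mass in the block `bc`), but acts explicitly. [folklore] -/
theorem conv_edgeBC_sigma (y lam mu Y V : ℝ) :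
    conv (edgeBC y) (sigmaVec lam mu Y V) = ⟨(1 - y) * (mu * Y), (1 - y) * (mu * V), (1 - y) * (lam * Y), y * (mu * Y), lam * V + y * (mu * V + lam * Y)⟩ := by
  ext <;> simp only [conv, edgeBC, sigmaVec, V5.total] <;> ring

/-! ### The cubic cone `x̂ŷẑ = û²v̂` -/

/-- The cubic form `𝒞(Z) = x̂ŷẑ − û²v̂` in hat coordinates `(û, x̂, ŷ, ẑ, v̂) = (Z₀, Z₀+Z_ab, Z₀+Z_ac, Z₀+Z_bc, |Z|)`. [folklore] -/
def cubicC (Z : V5) : ℝ := hx Z * hy Z * hz Z - Z.z0 ^ 2 * Z.total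

/-- **`Σ` lies on the cubic cone.** [folklore] -/
theorem cubicC_sigma (lam mu Y V : ℝ) : cubicC (sigmaVec lam mu Y V) = 0 := by
  simp only [cubicC, sigmaVec, hx, hy, hz, V5.total]; ring

/-- The pinned image of every `a`-fan lies on the cubic cone. [folklore] -/
theorem cubicC_fanCombo_pinned (q : ℝ) (F u : V5) : cubicC (fanCombo q F (conv (edgeAC 1) u)) = 0 := by
  rw [fanCombo_pinned]; exact cubicC_sigma _ _ _ _

/-- `δ₀` and the three single-edge letters lie on the cubic cone. [folklore] -/
theorem cubicC_delta0 : cubicC delta0 = 0 := by simp only [cubicC, delta0, hx, hy, hz, V5.total]; ring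

/-- The `ac`-edge letter lies on the cubic cone. [folklore] -/
theorem cubicC_edgeAC (x : ℝ) : cubicC (edgeAC x) = 0 := by simp only [cubicC, edgeAC, hx, hy, hz, V5.total]; ring

/-- The `bc`-edge letter lies on the cubic cone. [folklore] -/
theorem cubicC_edgeBC (y : ℝ) : cubicC (edgeBC y) = 0 := by simp only [cubicC, edgeBC, hx, hy, hz, V5.total]; ring

/-- The axis letter lies on the cubic cone. [folklore] -/
theorem cubicC_edgeAB (w : ℝ) : cubicC (edgeAB w) = 0 := by simp only [cubicC, edgeAB, hx, hy, hz, V5.total]; ring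

/-- **`a`-spokes preserve the cubic cone**: `𝒞(AC_x ∗ Z) = (1−x)²·𝒞(Z)`. [folklore] -/
theorem cubicC_conv_edgeAC (x : ℝ) (Z : V5) : cubicC (conv (edgeAC x) Z) = (1 - x) ^ 2 * cubicC Z := by
  simp only [cubicC, conv, edgeAC, hx, hy, hz, V5.total]; ring

/-- **`b`-spokes preserve the cubic cone**: `𝒞(BC_y ∗ Z) = (1−y)²·𝒞(Z)`. [folklore] -/
theorem cubicC_conv_edgeBC (y : ℝ) (Z : V5) : cubicC (conv (edgeBC y) Z) = (1 - y) ^ 2 * cubicC Z := by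
  simp only [cubicC, conv, edgeBC, hx, hy, hz, V5.total]; ring

/-- **The axis letter preserves the cubic cone**: `𝒞(AB_w ∗ Z) = (1−w)²·𝒞(Z)`. [folklore] -/
theorem cubicC_conv_edgeAB (w : ℝ) (Z : V5) : cubicC (conv (edgeAB w) Z) = (1 - w) ^ 2 * cubicC Z := by
  simp only [cubicC, conv, edgeAB, hx, hy, hz, V5.total]; ring

/-- **The obstruction vector**: a plane `BC_y ∗ (F_a·span(u, P_a u))` always contains the vector `BC_y ∗ fanCombo q F (AC_1∗u)`, which lies on
the cubic cone. [folklore] -/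
theorem cubicC_edgeBC_fanCombo_pinned (q y : ℝ) (F u : V5) : cubicC (conv (edgeBC y) (fanCombo q F (conv (edgeAC 1) u))) = 0 := by
  rw [cubicC_conv_edgeBC, cubicC_fanCombo_pinned, mul_zero]

/-- Rim steps do NOT preserve the cubic cone: `𝒞(E_r ∗ BC_y σ)` is an explicit multiple of `r y λ (1−r)(1−y) μ`, nonzero in general
(memo §1; `p = 1 − q`). [folklore] -/
theorem cubicC_rimStep_edgeBC_sigma (q r y lam mu Y V : ℝ) :
    cubicC (rimStep q r (conv (edgeBC y) (sigmaVec lam mu Y V))) =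
      Y ^ 2 * (Y + V) * (r * y * lam * (1 - r) * (1 - y) * mu) *
        (r * y * lam - q * (r * (1 - y) * mu + (1 - r) * ((1 - y) * lam + mu * (1 - (1 - q) * (1 - y))))) := by
  simp only [cubicC, rimStep, conv, edgeBC, sigmaVec, hx, hy, hz, V5.total]; ring

end ThreeApex

end FK

end Summit.CriticalPhenomena.PercolationContinuityZ3.Theorems
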